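import Summits.QuantumFields.GaugeBoot.Rows.GLYZc1D4Ent
import Summits.QuantumFields.GaugeBoot.Rows.GLYZc1D4HTab
import Summits.QuantumFields.GaugeBoot.Rows.GLYZc1D4STab
import Summits.QuantumFields.GaugeBoot.Rows.GLYZc1D4LTab
import HarnessLib

/-!
# Gauge-boot: kernel check of the REDUCTION IDENTITY for blocks 3, 4, 5, 6 (part 4/12)

Cell `pub-gaugeboot` (HOME `run/shared/lean/pub/pub-gaugeboot/`), seat lean1 (binding layer for rows C20–C31 = the certified
glyz-c1-rp-4D windows, FANOUT-PLAN A126 (2): label sets, class/witness tables, the reduction identity, soundness, per-β bindings).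

HONEST FRAMING (page 1 of every file of this cell): certified bounds on lattice expectations at STATED coupling,
gauge group, dimension and torus size; NOT a mass gap, NOT a continuum limit, NOT a string tension, NOT large `N`.
The venture is explicitly NOT Yang–Mills-summit-bearing (barriers `FixedCouplingUltralocality`,
`PerturbativeInvisibility`).

For each listed block `k` and all `i, j < bdim k`: the expansion of `(Y_k)ᵢᵀ · cls · (Y_k)ⱼ` over the raw class table
(`hcls` / `scls` / `lcls` of `GLYZc1D4HTab` / `GLYZc1D4STab` / `GLYZc1D4LTab`), normalised (sorted, merged, zeros dropped), EQUALS the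
problem files' entry `ent k i j` verbatim — `SVec.dropZero (SVec.normExpand (ycol k i) (ycol k j) cls) = ent k i j` —
checked by `decide +kernel` on index rectangles of ≤ 6500 expansion terms (the farm's per-theorem kernel budget) and
assembled per block (`red_ok_k`); plus the range facts `ycol_lt_k`. Consumed by `GLYZc1D4Red`.
-/

set_option Elab.async false

noncomputable section

open Literature.MathematicalPhysics.QuantumFieldTheory

namespace Summit.QuantumFields.GaugeBoot

namespace GLYZc1D4

/-- The raw-line indices of the columns of `Y_3` are `< 211`. -/
theorem ycol_lt_3 : ∀ i < bdim 3, ∀ p ∈ ycol 3 i, p.1 < 211 := by decide +kernel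

set_option maxHeartbeats 0 in
/-- Reduction identity, block 3, rows `0 ≤ i < 4`, columns `0 ≤ j < 4` (3136 expansion terms; kernel). -/
theorem red_ok_3_0 : ∀ i j : Fin (bdim 3), 0 ≤ i.val → i.val < 4 → 0 ≤ j.val → j.val < 4 →
    SVec.dropZero (SVec.normExpand (ycol 3 i) (ycol 3 j) fun a b => (hcls a b).val) = ent 3 i j := by
  decide +kernel

/-- **Reduction identity, block 3** (`H/irrep12(d3,c+)`, 4 × 4; 3136 expansion terms): the file entries are
`Y_3ᵀ·cls·Y_3` entry by entry. -/
theorem red_ok_3 (i j : Fin (bdim 3)) :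
    SVec.dropZero (SVec.normExpand (ycol 3 i) (ycol 3 j) fun a b => (hcls a b).val) = ent 3 i j := by
  have hi0 : 0 ≤ i.val := Nat.zero_le _
  have hj0 : 0 ≤ j.val := Nat.zero_le _
  have him : i.val < 4 := i.isLt
  have hjm : j.val < 4 := j.isLt
  exact red_ok_3_0 i j hi0 him hj0 hjm

/-- The raw-line indices of the columns of `Y_4` are `< 211`. -/
theorem ycol_lt_4 : ∀ i < bdim 4, ∀ p ∈ ycol 4 i, p.1 < 211 := by decide +kernel

set_option maxHeartbeats 0 in
/-- Reduction identity, block 4, rows `0 ≤ i < 3`, columns `0 ≤ j < 3` (2304 expansion terms; kernel). -/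
theorem red_ok_4_0 : ∀ i j : Fin (bdim 4), 0 ≤ i.val → i.val < 3 → 0 ≤ j.val → j.val < 3 →
    SVec.dropZero (SVec.normExpand (ycol 4 i) (ycol 4 j) fun a b => (hcls a b).val) = ent 4 i j := by
  decide +kernel

/-- **Reduction identity, block 4** (`H/irrep13(d3,c+)`, 3 × 3; 2304 expansion terms): the file entries are
`Y_4ᵀ·cls·Y_4` entry by entry. -/
theorem red_ok_4 (i j : Fin (bdim 4)) :
    SVec.dropZero (SVec.normExpand (ycol 4 i) (ycol 4 j) fun a b => (hcls a b).val) = ent 4 i j := by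
  have hi0 : 0 ≤ i.val := Nat.zero_le _
  have hj0 : 0 ≤ j.val := Nat.zero_le _
  have him : i.val < 3 := i.isLt
  have hjm : j.val < 3 := j.isLt
  exact red_ok_4_0 i j hi0 him hj0 hjm

/-- The raw-line indices of the columns of `Y_5` are `< 211`. -/
theorem ycol_lt_5 : ∀ i < bdim 5, ∀ p ∈ ycol 5 i, p.1 < 211 := by decide +kernel

set_option maxHeartbeats 0 in
/-- Reduction identity, block 5, rows `0 ≤ i < 4`, columns `0 ≤ j < 10` (6448 expansion terms; kernel). -/
theorem red_ok_5_0 : ∀ i j : Fin (bdim 5), 0 ≤ i.val → i.val < 4 → 0 ≤ j.val → j.val < 10 →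
    SVec.dropZero (SVec.normExpand (ycol 5 i) (ycol 5 j) fun a b => (hcls a b).val) = ent 5 i j := by
  decide +kernel

set_option maxHeartbeats 0 in
/-- Reduction identity, block 5, rows `4 ≤ i < 8`, columns `0 ≤ j < 10` (6448 expansion terms; kernel). -/
theorem red_ok_5_1 : ∀ i j : Fin (bdim 5), 4 ≤ i.val → i.val < 8 → 0 ≤ j.val → j.val < 10 →
    SVec.dropZero (SVec.normExpand (ycol 5 i) (ycol 5 j) fun a b => (hcls a b).val) = ent 5 i j := by
  decide +kernel

set_option maxHeartbeats 0 in
/-- Reduction identity, block 5, rows `8 ≤ i < 10`, columns `0 ≤ j < 10` (2480 expansion terms; kernel). -/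
theorem red_ok_5_2 : ∀ i j : Fin (bdim 5), 8 ≤ i.val → i.val < 10 → 0 ≤ j.val → j.val < 10 →
    SVec.dropZero (SVec.normExpand (ycol 5 i) (ycol 5 j) fun a b => (hcls a b).val) = ent 5 i j := by
  decide +kernel

/-- **Reduction identity, block 5** (`H/irrep14(d3,c+)`, 10 × 10; 15376 expansion terms): the file entries are
`Y_5ᵀ·cls·Y_5` entry by entry. -/
theorem red_ok_5 (i j : Fin (bdim 5)) :
    SVec.dropZero (SVec.normExpand (ycol 5 i) (ycol 5 j) fun a b => (hcls a b).val) = ent 5 i j := by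
  have hi0 : 0 ≤ i.val := Nat.zero_le _
  have hj0 : 0 ≤ j.val := Nat.zero_le _
  have him : i.val < 10 := i.isLt
  have hjm : j.val < 10 := j.isLt
  rcases Nat.lt_or_ge i.val 4 with hi1 | hi1
  · exact red_ok_5_0 i j hi0 hi1 hj0 hjm
  rcases Nat.lt_or_ge i.val 8 with hi2 | hi2
  · exact red_ok_5_1 i j hi1 hi2 hj0 hjm
  exact red_ok_5_2 i j hi2 him hj0 hjm

/-- The raw-line indices of the columns of `Y_6` are `< 211`. -/
theorem ycol_lt_6 : ∀ i < bdim 6, ∀ p ∈ ycol 6 i, p.1 < 211 := by decide +kernel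

set_option maxHeartbeats 0 in
/-- Reduction identity, block 6, rows `0 ≤ i < 3`, columns `0 ≤ j < 7` (5376 expansion terms; kernel). -/
theorem red_ok_6_0 : ∀ i j : Fin (bdim 6), 0 ≤ i.val → i.val < 3 → 0 ≤ j.val → j.val < 7 →
    SVec.dropZero (SVec.normExpand (ycol 6 i) (ycol 6 j) fun a b => (hcls a b).val) = ent 6 i j := by
  decide +kernel

set_option maxHeartbeats 0 in
/-- Reduction identity, block 6, rows `3 ≤ i < 6`, columns `0 ≤ j < 7` (5376 expansion terms; kernel). -/
theorem red_ok_6_1 : ∀ i j : Fin (bdim 6), 3 ≤ i.val → i.val < 6 → 0 ≤ j.val → j.val < 7 →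
    SVec.dropZero (SVec.normExpand (ycol 6 i) (ycol 6 j) fun a b => (hcls a b).val) = ent 6 i j := by
  decide +kernel

set_option maxHeartbeats 0 in
/-- Reduction identity, block 6, rows `6 ≤ i < 7`, columns `0 ≤ j < 7` (1792 expansion terms; kernel). -/
theorem red_ok_6_2 : ∀ i j : Fin (bdim 6), 6 ≤ i.val → i.val < 7 → 0 ≤ j.val → j.val < 7 →
    SVec.dropZero (SVec.normExpand (ycol 6 i) (ycol 6 j) fun a b => (hcls a b).val) = ent 6 i j := by
  decide +kernel

/-- **Reduction identity, block 6** (`H/irrep15(d3,c+)`, 7 × 7; 12544 expansion terms): the file entries are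
`Y_6ᵀ·cls·Y_6` entry by entry. -/
theorem red_ok_6 (i j : Fin (bdim 6)) :
    SVec.dropZero (SVec.normExpand (ycol 6 i) (ycol 6 j) fun a b => (hcls a b).val) = ent 6 i j := by
  have hi0 : 0 ≤ i.val := Nat.zero_le _
  have hj0 : 0 ≤ j.val := Nat.zero_le _
  have him : i.val < 7 := i.isLt
  have hjm : j.val < 7 := j.isLt
  rcases Nat.lt_or_ge i.val 3 with hi1 | hi1
  · exact red_ok_6_0 i j hi0 hi1 hj0 hjm
  rcases Nat.lt_or_ge i.val 6 with hi2 | hi2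
  · exact red_ok_6_1 i j hi1 hi2 hj0 hjm
  exact red_ok_6_2 i j hi2 him hj0 hjm

end GLYZc1D4

end Summit.QuantumFields.GaugeBoot

end
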